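import Literature.Dynamics.Tilings.OllingerSFT
import HarnessLib

/-!
# The Ollinger subshift codes its substitution, and is aperiodic (Ollinger's Theorem 1)

Continuation of `OllingerSFT.lean` (tilings `x : ℤ × ℤ → GoodTile` by Ollinger's 104 tiles):

* `decompose` — **"`τ` codes `s`"**: every tiling `x` is, up to the translation
  `basePt x ∈ {0,1}²`, the image under the substitution of a tiling `y`:
  `x (u + 2z + r) = s_r (y z)` (the parity layer of a tiling is one of the four checkerboards,
  `par_bpos`; each block on parities `[01 11 / 00 10]` decodes, `decode_h`/`decode_v`/
  `decode_good_or_bad`, the two bad families being excluded by the cells below / to the left,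
  `not_bad_v_below`/`not_bad_h_left`; the decoded configuration `decG` is a tiling by the
  matching transfer);
* `isAperiodic_ollingerShift` — **Ollinger's Theorem 1: the tile set is aperiodic**, in the strong
  sense `IsAperiodic` (no tiling has any non-zero period): a period preserves the parity
  checkerboard, hence is even, `2p'`, and then `p'` is a period of the decoded tiling
  (injectivity of `s`); induction on `|p₁| + |p₂|` (Ollinger Prop. 3: "Let `p` be the smallest
  non-trivial period … `p` has to be a multiple of `2` … `C'` is `p'`-periodic and `p'` is
  smaller than `p`"; Prop. 4: "a tile set both admitting a tiling and coding an unambiguous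
  substitution is aperiodic").

## References

* N. Ollinger, *Two-by-Two Substitution Systems and the Undecidability of the Domino Problem*,
  CiE 2008, LNCS 5028, doi:10.1007/978-3-540-69407-6_51, Props. 3–4, §3 Thm. 1.
* E. Jeandel, P. Vanier, *The Undecidability of the Domino Problem*, LNM 2273 (2020), §3.2
  Prop. 8 (the same argument).
-/

namespace Literature.Dynamics.Tilings.Ollinger

open Tile
open Literature.Dynamics.SymbolicDynamics (IsSFT IsAperiodic)
open _root_.SymbolicDynamics.FullShift

/-! ### The parity layer of a tiling is a checkerboard -/

section Decompose

variable {x : ℤ × ℤ → GoodTile}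

/-- The parity of the cell `p` of `x`. [cite: Ollinger2008, §2 Example 4] -/
def par (x : ℤ × ℤ → GoodTile) (p : ℤ × ℤ) : B2 := (x p).1.l

/-- One step east flips the first parity bit. [cite: Ollinger2008, §2 Example 4] -/
theorem par_add_one_fst (hx : IsOTiling x) (i j : ℤ) : par x (i + 1, j) = lE (par x (i, j)) := by
  have h := (hx i j).1
  simp only [hmatch, Bool.and_eq_true, beq_iff_eq] at h
  exact h.1.symm

/-- One step north flips the second parity bit. [cite: Ollinger2008, §2 Example 4] -/
theorem par_add_one_snd (hx : IsOTiling x) (i j : ℤ) : par x (i, j + 1) = lN (par x (i, j)) := by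
  have h := (hx i j).2
  simp only [vmatch, Bool.and_eq_true, beq_iff_eq] at h
  exact h.1.symm

/-- One step west flips the first parity bit. [cite: Ollinger2008, §2 Example 4] -/
theorem par_sub_one_fst (hx : IsOTiling x) (i j : ℤ) : par x (i - 1, j) = lE (par x (i, j)) := by
  have h := par_add_one_fst hx (i - 1) j
  rw [sub_add_cancel] at h
  rw [h]
  simp [lE]

/-- One step south flips the second parity bit. [cite: Ollinger2008, §2 Example 4] -/
theorem par_sub_one_snd (hx : IsOTiling x) (i j : ℤ) : par x (i, j - 1) = lN (par x (i, j)) := by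
  have h := par_add_one_snd hx i (j - 1)
  rw [sub_add_cancel] at h
  rw [h]
  simp [lN]

/-- Two steps east or west do not change the parity. [cite: Ollinger2008, §2 Example 4] -/
theorem par_add_two_mul_fst (hx : IsOTiling x) (i j k : ℤ) : par x (i + 2 * k, j) = par x (i, j) := by
  induction k using Int.induction_on with
  | zero => simp
  | succ k ih =>
    rw [show i + 2 * ((k : ℤ) + 1) = i + 2 * k + 1 + 1 by ring, par_add_one_fst hx,
      par_add_one_fst hx, ih]
    simp [lE]
  | pred k ih =>
    rw [show i + 2 * (-(k : ℤ) - 1) = i + 2 * (-k) - 1 - 1 by ring, par_sub_one_fst hx,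
      par_sub_one_fst hx, ih]
    simp [lE]

/-- Two steps north or south do not change the parity. [cite: Ollinger2008, §2 Example 4] -/
theorem par_add_two_mul_snd (hx : IsOTiling x) (i j k : ℤ) : par x (i, j + 2 * k) = par x (i, j) := by
  induction k using Int.induction_on with
  | zero => simp
  | succ k ih =>
    rw [show j + 2 * ((k : ℤ) + 1) = j + 2 * k + 1 + 1 by ring, par_add_one_snd hx,
      par_add_one_snd hx, ih]
    simp [lN]
  | pred k ih =>
    rw [show j + 2 * (-(k : ℤ) - 1) = j + 2 * (-k) - 1 - 1 by ring, par_sub_one_snd hx,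
      par_sub_one_snd hx, ih]
    simp [lN]

/-- Moving vertically does not change the first parity bit. [cite: Ollinger2008, §2 Example 4] -/
theorem par_fst_add_snd (hx : IsOTiling x) (i j k : ℤ) : (par x (i, j + k)).1 = (par x (i, j)).1 := by
  induction k using Int.induction_on with
  | zero => simp
  | succ k ih => rw [← add_assoc, par_add_one_snd hx]; simpa [lN] using ih
  | pred k ih =>
    rw [show j + (-(k : ℤ) - 1) = j + -k - 1 by ring, par_sub_one_snd hx]
    simpa [lN] using ih

/-- Moving horizontally does not change the second parity bit. [cite: Ollinger2008, §2 Example 4] -/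
theorem par_snd_add_fst (hx : IsOTiling x) (i j k : ℤ) : (par x (i + k, j)).2 = (par x (i, j)).2 := by
  induction k using Int.induction_on with
  | zero => simp
  | succ k ih => rw [← add_assoc, par_add_one_fst hx]; simpa [lE] using ih
  | pred k ih =>
    rw [show i + (-(k : ℤ) - 1) = i + -k - 1 by ring, par_sub_one_fst hx]
    simpa [lE] using ih

/-- The **base point** `u ∈ {0,1}²` of a tiling: a cell of parity `00`. [cite: Ollinger2008, §3 (proof of Thm. 1)] -/
def basePt (x : ℤ × ℤ → GoodTile) : ℤ × ℤ :=
  (cond (par x (0, 0)).1 1 0, cond (par x (0, 0)).2 1 0)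

/-- The base point has parity `00`. [cite: Ollinger2008, §3 (proof of Thm. 1)] -/
theorem par_basePt (hx : IsOTiling x) : par x (basePt x) = (false, false) := by
  unfold basePt
  have h1 : par x (cond (par x (0, 0)).1 1 0, (0 : ℤ)) = (false, (par x (0, 0)).2) := by
    cases hb : (par x (0, 0)).1
    · simp only [cond_false]
      rw [← hb]
    · simp only [cond_true]
      have := par_add_one_fst hx 0 0
      rw [zero_add] at this
      rw [this]
      simp [lE, hb]
  cases hb2 : (par x (0, 0)).2
  · simpa [hb2] using h1
  · simp only [cond_true]
    have := par_add_one_snd hx (cond (par x (0, 0)).1 1 0) 0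
    rw [zero_add] at this
    rw [this, h1]
    simp [lN, hb2]

/-- Integer coordinate of a bit. [folklore] -/
def bz (b : Bool) : ℤ := cond b 1 0

/-- The cell `r ∈ {0,1}²` of the block `z` of the grid based at `u`: `u + 2z + r`.
[cite: Ollinger2008, §1] -/
def bpos (u z : ℤ × ℤ) (r : B2) : ℤ × ℤ := (u.1 + 2 * z.1 + bz r.1, u.2 + 2 * z.2 + bz r.2)

/-- [folklore] -/
@[simp] theorem bpos_ff (u z : ℤ × ℤ) : bpos u z (false, false) = (u.1 + 2 * z.1, u.2 + 2 * z.2) := by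
  simp [bpos, bz]

/-- [folklore] -/
@[simp] theorem bpos_tf (u z : ℤ × ℤ) : bpos u z (true, false) = (u.1 + 2 * z.1 + 1, u.2 + 2 * z.2) := by
  simp [bpos, bz]

/-- [folklore] -/
@[simp] theorem bpos_ft (u z : ℤ × ℤ) : bpos u z (false, true) = (u.1 + 2 * z.1, u.2 + 2 * z.2 + 1) := by
  simp [bpos, bz]

/-- [folklore] -/
@[simp] theorem bpos_tt (u z : ℤ × ℤ) :
    bpos u z (true, true) = (u.1 + 2 * z.1 + 1, u.2 + 2 * z.2 + 1) := by
  simp [bpos, bz]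

/-- A translation by `2p'` moves blocks to blocks. [folklore] -/
theorem bpos_add (u z p' : ℤ × ℤ) (r : B2) :
    bpos u (p' + z) r = ((2 * p'.1, 2 * p'.2) : ℤ × ℤ) + bpos u z r := by
  obtain ⟨_ | _, _ | _⟩ := r <;> simp [bpos, bz] <;> constructor <;> ring

/-- **The parity layer is a checkerboard**: the cell `r` of every block has parity `r`.
[cite: Ollinger2008, §3 (proof of Thm. 1: "As layer 1 admits only 4 tilings")] -/
theorem par_bpos (hx : IsOTiling x) (z : ℤ × ℤ) (r : B2) : par x (bpos (basePt x) z r) = r := by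
  have h0 := par_basePt hx
  set u := basePt x with hu
  -- first move horizontally, then vertically
  have hh : ∀ r1 : Bool, par x (u.1 + 2 * z.1 + bz r1, u.2) = (r1, false) := by
    intro r1
    cases r1
    · rw [show bz false = 0 from rfl, add_zero, par_add_two_mul_fst hx, show (u.1, u.2) = u from rfl,
        h0]
    · rw [show bz true = 1 from rfl, par_add_one_fst hx, par_add_two_mul_fst hx,
        show (u.1, u.2) = u from rfl, h0]
      rfl
  obtain ⟨r1, r2⟩ := r
  show par x (u.1 + 2 * z.1 + bz r1, u.2 + 2 * z.2 + bz r2) = (r1, r2)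
  cases r2
  · rw [show bz false = 0 from rfl, add_zero, par_add_two_mul_snd hx, hh]
  · rw [show bz true = 1 from rfl, par_add_one_snd hx, par_add_two_mul_snd hx, hh]
    rfl

/-! ### Decoding the blocks -/

/-- The corner type of a tile (junk for non-corners). [cite: Ollinger2008, §3] -/
def cornerType (t : Tile) : B2 :=
  match t.c with
  | .X q => q
  | _ => (false, false)

/-- A good tile of parity `11` is a corner. [cite: Ollinger2008, §3] -/
theorem eq_X_of_good {t : Tile} (hg : t.good = true) (hl : t.l = (true, true)) :
    t = ⟨(true, true), .X (cornerType t)⟩ := by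
  obtain ⟨l, c⟩ := t
  simp only at hl
  subst hl
  cases c with
  | X q => rfl
  | H h d ν => simp [Tile.good] at hg
  | V v d η => simp [Tile.good] at hg

/-- A tile is determined by its parity and its core. [folklore] -/
theorem tile_eq_of_l {t : Tile} {l : B2} (hl : t.l = l) : t = ⟨l, t.c⟩ := by
  obtain ⟨l', c⟩ := t
  simp only at hl
  subst hl
  rfl

/-- The wire colour constraint holds for good tiles. [cite: Ollinger2008, §3] -/
theorem wcc_of_good {t : Tile} (hg : t.good = true) : t.c.wcc = true := by
  simp only [Tile.good, Bool.and_eq_true] at hg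
  exact hg.1

/-- The **decoded tile** of the block `z`: corner type of its `11`-cell, core of its `00`-cell.
[cite: Ollinger2008, §3 (proof of Thm. 1)] -/
def decT (x : ℤ × ℤ → GoodTile) (z : ℤ × ℤ) : Tile :=
  ⟨cornerType (x ((basePt x).1 + 2 * z.1 + 1, (basePt x).2 + 2 * z.2 + 1)).1,
    (x ((basePt x).1 + 2 * z.1, (basePt x).2 + 2 * z.2)).1.c⟩

/-- **Every block of a tiling is the image of its decoded tile**: cell `r` of block `z` is
`s_r (decT z)`. [cite: Ollinger2008, §3 (proof of Thm. 1: "`u · T|□` has to be the image of a tile by `s`")] -/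
theorem apply_bpos_eq_subst (hx : IsOTiling x) (z : ℤ × ℤ) (r : B2) :
    (x (bpos (basePt x) z r)).1 = subst r (decT x z) := by
  -- parities of the four cells
  have l00 : (x ((basePt x).1 + 2 * z.1, (basePt x).2 + 2 * z.2)).1.l = (false, false) := by
    simpa [par] using par_bpos hx z (false, false)
  have l10 : (x ((basePt x).1 + 2 * z.1 + 1, (basePt x).2 + 2 * z.2)).1.l = (true, false) := by
    simpa [par] using par_bpos hx z (true, false)
  have l01 : (x ((basePt x).1 + 2 * z.1, (basePt x).2 + 2 * z.2 + 1)).1.l = (false, true) := by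
    simpa [par] using par_bpos hx z (false, true)
  have l11 : (x ((basePt x).1 + 2 * z.1 + 1, (basePt x).2 + 2 * z.2 + 1)).1.l = (true, true) := by
    simpa [par] using par_bpos hx z (true, true)
  -- the `00`- and `11`-cells
  have e00 : (x ((basePt x).1 + 2 * z.1, (basePt x).2 + 2 * z.2)).1 =
      ⟨(false, false), (decT x z).c⟩ := tile_eq_of_l l00
  have e11 : (x ((basePt x).1 + 2 * z.1 + 1, (basePt x).2 + 2 * z.2 + 1)).1 =
      ⟨(true, true), .X (decT x z).l⟩ :=
    eq_X_of_good (x ((basePt x).1 + 2 * z.1 + 1, (basePt x).2 + 2 * z.2 + 1)).2 l11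
  -- the `10`- and `01`-cells decode
  have e10 : (x ((basePt x).1 + 2 * z.1 + 1, (basePt x).2 + 2 * z.2)).1 =
      subst (true, false) (decT x z) := by
    refine decode_h (decT x z).c (decT x z).l (x _).2 l10 ?_ ?_
    · rw [← e00]; exact (hx _ _).1
    · rw [← e11]; exact (hx _ _).2
  have e01 : (x ((basePt x).1 + 2 * z.1, (basePt x).2 + 2 * z.2 + 1)).1 =
      subst (false, true) (decT x z) := by
    refine decode_v (decT x z).c (decT x z).l (x _).2 l01 ?_ ?_
    · rw [← e00]; exact (hx _ _).2
    · rw [← e11]; exact (hx _ _).1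
  obtain ⟨_ | _, _ | _⟩ := r
  · rw [bpos_ff, e00]; rfl
  · rw [bpos_ft, e01]
  · rw [bpos_tf, e10]
  · rw [bpos_tt, e11]; rfl

/-- **The decoded tile is a good tile**: the two bad families cannot occur in a tiling (look at
the two cells below, resp. to the left of, the block). [cite: Ollinger2008, §3 (proof of Thm. 1)] -/
theorem good_decT (hx : IsOTiling x) (z : ℤ × ℤ) : (decT x z).good = true := by
  have e00 : (x ((basePt x).1 + 2 * z.1, (basePt x).2 + 2 * z.2)).1 =
      subst (false, false) (decT x z) := by
    rw [← bpos_ff]; exact apply_bpos_eq_subst hx z (false, false)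
  have e10 : (x ((basePt x).1 + 2 * z.1 + 1, (basePt x).2 + 2 * z.2)).1 =
      subst (true, false) (decT x z) := by
    rw [← bpos_tf]; exact apply_bpos_eq_subst hx z (true, false)
  have e01 : (x ((basePt x).1 + 2 * z.1, (basePt x).2 + 2 * z.2 + 1)).1 =
      subst (false, true) (decT x z) := by
    rw [← bpos_ft]; exact apply_bpos_eq_subst hx z (false, true)
  have hwcc : (decT x z).c.wcc = true :=
    wcc_of_good (t := (x ((basePt x).1 + 2 * z.1, (basePt x).2 + 2 * z.2)).1) (x _).2
  have h10 : (subst (true, false) (decT x z)).good = true := e10 ▸ (x _).2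
  have h01 : (subst (false, true) (decT x z)).good = true := e01 ▸ (x _).2
  rcases decode_good_or_bad (decT x z).l (decT x z).c hwcc h10 h01 with h | hbad
  · exact h
  exfalso
  rcases (isBad_iff _ _).mp hbad with ⟨hq, v, η, hc⟩ | ⟨hq, h, ν, hc⟩
  · -- first family: the two cells below
    have hd : decT x z = ⟨(true, false), .V v true η⟩ := by
      rw [tile_eq_of_l hq, hc]
    set a : ℤ := (basePt x).1 + 2 * z.1 with ha
    set b : ℤ := (basePt x).2 + 2 * z.2 with hb
    refine not_bad_v_below v η (x (a, b - 1)).1 (x (a + 1, b - 1)).1 (x (a, b - 1)).2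
      (x (a + 1, b - 1)).2 ?_ (hx a (b - 1)).1 ?_
    · have := (hx a (b - 1)).2
      rw [sub_add_cancel, e00, hd] at this
      exact this
    · have := (hx (a + 1) (b - 1)).2
      rw [sub_add_cancel, e10, hd] at this
      exact this
  · -- second family: the two cells to the left
    have hd : decT x z = ⟨(false, true), .H h true ν⟩ := by
      rw [tile_eq_of_l hq, hc]
    set a : ℤ := (basePt x).1 + 2 * z.1 with ha
    set b : ℤ := (basePt x).2 + 2 * z.2 with hb
    refine not_bad_h_left h ν (x (a - 1, b)).1 (x (a - 1, b + 1)).1 (x (a - 1, b)).2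
      (x (a - 1, b + 1)).2 ?_ (hx (a - 1) b).2 ?_
    · have := (hx (a - 1) b).1
      rw [sub_add_cancel, e00, hd] at this
      exact this
    · have := (hx (a - 1) (b + 1)).1
      rw [sub_add_cancel, e01, hd] at this
      exact this

/-- The **decoded tiling** `y` of a tiling `x` (`x = u · S(y)`). [cite: Ollinger2008, §3 (proof of Thm. 1)] -/
def decG (hx : IsOTiling x) (z : ℤ × ℤ) : GoodTile := ⟨decT x z, good_decT hx z⟩

/-- **The decoded configuration is a tiling** (matching transfer: "if two tile images `s(a)` and
`s(b)` match, then `a` and `b` match"). [cite: Ollinger2008, §3 (proof of Thm. 1)] -/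
theorem isOTiling_decG (hx : IsOTiling x) : IsOTiling (decG hx) := by
  intro i j
  have hgz := good_decT hx (i, j)
  constructor
  · have hgz' := good_decT hx (i + 1, j)
    show hmatch (decT x (i, j)) (decT x (i + 1, j)) = true
    rw [hmatch_iff_blocks hgz hgz', ← apply_bpos_eq_subst hx (i, j), ← apply_bpos_eq_subst hx (i, j),
      ← apply_bpos_eq_subst hx (i + 1, j), ← apply_bpos_eq_subst hx (i + 1, j)]
    simp only [bpos_tf, bpos_ff, bpos_tt, bpos_ft, Bool.and_eq_true]
    constructor
    · have := (hx ((basePt x).1 + 2 * i + 1) ((basePt x).2 + 2 * j)).1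
      rwa [show (basePt x).1 + 2 * i + 1 + 1 = (basePt x).1 + 2 * (i + 1) by ring] at this
    · have := (hx ((basePt x).1 + 2 * i + 1) ((basePt x).2 + 2 * j + 1)).1
      rwa [show (basePt x).1 + 2 * i + 1 + 1 = (basePt x).1 + 2 * (i + 1) by ring] at this
  · have hgz' := good_decT hx (i, j + 1)
    show vmatch (decT x (i, j)) (decT x (i, j + 1)) = true
    rw [vmatch_iff_blocks hgz hgz', ← apply_bpos_eq_subst hx (i, j), ← apply_bpos_eq_subst hx (i, j),
      ← apply_bpos_eq_subst hx (i, j + 1), ← apply_bpos_eq_subst hx (i, j + 1)]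
    simp only [bpos_tf, bpos_ff, bpos_tt, bpos_ft, Bool.and_eq_true]
    constructor
    · have := (hx ((basePt x).1 + 2 * i) ((basePt x).2 + 2 * j + 1)).2
      rwa [show (basePt x).2 + 2 * j + 1 + 1 = (basePt x).2 + 2 * (j + 1) by ring] at this
    · have := (hx ((basePt x).1 + 2 * i + 1) ((basePt x).2 + 2 * j + 1)).2
      rwa [show (basePt x).2 + 2 * j + 1 + 1 = (basePt x).2 + 2 * (j + 1) by ring] at this

/-- **"The tile set `τ` codes `s`"**: every tiling is, up to the translation `basePt x ∈ {0,1}²`,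
the image under the substitution of a tiling: `x (u + 2z + r) = s_r (y z)`.
[cite: Ollinger2008, §3 (proof of Thm. 1: "`X_τ = {u · s(C) | C ∈ X_τ, u ∈ □}`")] -/
theorem decompose (hx : IsOTiling x) : ∃ y : ℤ × ℤ → GoodTile, IsOTiling y ∧
    ∀ (z : ℤ × ℤ) (r : B2), x (bpos (basePt x) z r) = substG r (y z) :=
  ⟨decG hx, isOTiling_decG hx, fun z r => Subtype.ext (apply_bpos_eq_subst hx z r)⟩

/-- The base point lies in `{0,1}²`. [cite: Ollinger2008, §3 (proof of Thm. 1)] -/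
theorem basePt_mem (x : ℤ × ℤ → GoodTile) :
    ((basePt x).1 = 0 ∨ (basePt x).1 = 1) ∧ ((basePt x).2 = 0 ∨ (basePt x).2 = 1) := by
  unfold basePt
  constructor
  · cases (par x (0, 0)).1 <;> simp
  · cases (par x (0, 0)).2 <;> simp

end Decompose

/-! ### Aperiodicity -/

section Aperiodic

variable {x : ℤ × ℤ → GoodTile}

/-- An odd vertical displacement flips the second parity bit. [cite: Ollinger2008, §2 Example 4] -/
theorem par_snd_odd (hx : IsOTiling x) (i b : ℤ) : (par x (i, 2 * b + 1)).2 = !(par x (i, 0)).2 := by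
  rw [par_add_one_snd hx, show (2 * b : ℤ) = 0 + 2 * b by ring, par_add_two_mul_snd hx]
  simp [lN]

/-- An odd horizontal displacement flips the first parity bit. [cite: Ollinger2008, §2 Example 4] -/
theorem par_fst_odd (hx : IsOTiling x) (a j : ℤ) : (par x (2 * a + 1, j)).1 = !(par x (0, j)).1 := by
  rw [par_add_one_fst hx, show (2 * a : ℤ) = 0 + 2 * a by ring, par_add_two_mul_fst hx]
  simp [lE]

/-- **A period of a tiling is even**: it preserves the parity checkerboard.
[cite: Ollinger2008, Prop. 3 (proof: "`p` has to be a multiple of `2`")] -/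
theorem even_of_period (hx : IsOTiling x) {p : ℤ × ℤ} (hper : ∀ w, x (p + w) = x w) :
    ∃ p' : ℤ × ℤ, p = ((2 * p'.1, 2 * p'.2) : ℤ × ℤ) := by
  have hp : par x (p.1, p.2) = par x (0, 0) := by
    have := hper 0
    rw [add_zero] at this
    exact congrArg (fun t : GoodTile => t.1.l) this
  -- the second coordinate is even
  have h2 : ∃ b, p.2 = 2 * b := by
    obtain ⟨b, hb | hb⟩ := Int.even_or_odd' p.2
    · exact ⟨b, hb⟩
    · exfalso
      have e := congrArg Prod.snd hp
      rw [hb, par_snd_odd hx, ← zero_add p.1, par_snd_add_fst hx 0 0 p.1] at e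
      cases hb2 : (par x (0, 0)).2 <;> simp [hb2] at e
  -- the first coordinate is even
  have h1 : ∃ a, p.1 = 2 * a := by
    obtain ⟨a, ha | ha⟩ := Int.even_or_odd' p.1
    · exact ⟨a, ha⟩
    · exfalso
      have e := congrArg Prod.fst hp
      rw [ha, par_fst_odd hx, ← zero_add p.2, par_fst_add_snd hx 0 0 p.2] at e
      cases hb1 : (par x (0, 0)).1 <;> simp [hb1] at e
  obtain ⟨a, ha⟩ := h1
  obtain ⟨b, hb⟩ := h2
  exact ⟨(a, b), Prod.ext ha hb⟩

/-- **Half a period is a period of the decoded tiling** (injectivity of `s`).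
[cite: Ollinger2008, Prop. 3 (proof: "`C'` is `p'`-periodic")] -/
theorem shift_decG_eq (hx : IsOTiling x) {p' : ℤ × ℤ}
    (hper : ∀ w, x (((2 * p'.1, 2 * p'.2) : ℤ × ℤ) + w) = x w) : shift p' (decG hx) = decG hx := by
  funext w
  apply Subtype.ext
  show decT x (p' + w) = decT x w
  apply subst_injective
  · rw [← apply_bpos_eq_subst hx (p' + w), ← apply_bpos_eq_subst hx w, bpos_add, hper]
  · rw [← apply_bpos_eq_subst hx (p' + w), ← apply_bpos_eq_subst hx w, bpos_add, hper]

end Aperiodic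

/-- **Ollinger's Theorem 1: the tile set is aperiodic** — no tiling of the plane by the 104 tiles
has a non-zero period (`IsAperiodic`). By induction on `|p₁| + |p₂|`: a period `p ≠ 0` of a
tiling `x` is even, `p = 2p'`, and `p' ≠ 0` is a period of the decoded tiling, with smaller
`|p'₁| + |p'₂|` ("Let `p` be the smallest non-trivial period … contradicting our hypothesis").
[cite: Ollinger2008, Thm. 1 and Prop. 3] -/
theorem isAperiodic_ollingerShift : IsAperiodic ollingerShift := by
  suffices H : ∀ (n : ℕ) (x : ℤ × ℤ → GoodTile), IsOTiling x → ∀ p : ℤ × ℤ, p ≠ 0 →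
      p.1.natAbs + p.2.natAbs ≤ n → shift p x ≠ x by
    intro x hx p hp
    exact H _ x hx p hp le_rfl
  intro n
  induction n with
  | zero =>
    intro x _ p hp hn _
    apply hp
    exact Prod.ext (Int.natAbs_eq_zero.mp (by omega)) (Int.natAbs_eq_zero.mp (by omega))
  | succ n ih =>
    intro x hx p hp hn hper
    have hper' : ∀ w, x (p + w) = x w := fun w => congrFun hper w
    obtain ⟨p', rfl⟩ := even_of_period hx hper'
    have hp' : p' ≠ 0 := by
      rintro rfl
      exact hp (by simp)
    refine ih (decG hx) (isOTiling_decG hx) p' hp' ?_ (shift_decG_eq hx hper')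
    have e1 : (2 * p'.1).natAbs = 2 * p'.1.natAbs := by rw [Int.natAbs_mul]; rfl
    have e2 : (2 * p'.2).natAbs = 2 * p'.2.natAbs := by rw [Int.natAbs_mul]; rfl
    dsimp only at hn
    rw [e1, e2] at hn
    have hne : p'.1.natAbs + p'.2.natAbs ≠ 0 := by
      intro h0
      apply hp'
      exact Prod.ext (Int.natAbs_eq_zero.mp (by omega)) (Int.natAbs_eq_zero.mp (by omega))
    omega

end Literature.Dynamics.Tilings.Ollinger
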